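import Mathlib
import HarnessLib
import Literature.MathematicalPhysics.QuantumLattice.HubbardUVSymbolBandComposition
import Literature.MathematicalPhysics.QuantumLattice.HubbardUVSymbolMixedSmooth
import Summits.HubbardSuperconductivity.HubbardSuperconductivity.Theorems.KLProgrammeSampledPeriodicSymbolKernelL1Deriv
import Summits.HubbardSuperconductivity.HubbardSuperconductivity.Theorems.KLProgrammeKLRegimeTwoVolumeResummedSymbolKernels
import Summits.HubbardSuperconductivity.HubbardSuperconductivity.Theorems.KLProgrammeKLRegimeTwoVolumeSampledKernels
import Summits.HubbardSuperconductivity.HubbardSuperconductivity.Theorems.KLProgrammeKLRegimeEngineFrameLevelCount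

/-!
# K3 two-volume read-out, work-order (r4) — the MODEL numbers: `‖ǔ‖₁`, `M₁(ǔ)` of the fixed-frequency ultraviolet symbol
# `u(q) = Ψ(ω, e_K(q))` sampled on the torus, and the resummed-symbol sizes `‖τ̌‖₁`, `M₁(τ̌)`, far|c_{Re E}|` keyed to band data

Cell gate-hubbard-kl, seat hubbard-kl-k3c5-p1 (g8).  Sequel of `…TwoVolumeResummedSymbolKernels` (resolvent bounds in terms of `‖ǔ‖₁`, `M₁(ǔ)`,
`‖Ǩ‖₁`, `M₁(Ǩ)`) and `…SampledPeriodicSymbolKernelL1Deriv` (kernel sizes of a sampled periodic symbol from Fréchet bounds).  Here the symbol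
of the read-out is made explicit: `u(q) = uvSymbolFn 1 Λ (e_K q) ω = Ψ(ω, e_K(q))` (k3c4-p2's jointly smooth `uvSymbol₂ 1 Λ` composed with the
frame band `frameLevel μ K`; `uvSymbolCT = βL²·u∘p` is k3c5-p2's `uvSymbolCT_eq_mul_sampled`).  From [tree] `norm_iteratedFDeriv_uvSymbol₂_le`
(`‖DⁱΨ‖ ≤ B(i+1)!(2/m(ω))^{i+1}`) and the crude Faà di Bruno [tree] `norm_iteratedFDeriv_uvSymbol₂_comp_band_le`, for a band with graded sizes
`‖Dⁱe_K‖ ≤ Dⁱ` (`1 ≤ i ≤ 3`) and a cutoff-derivative bound `B` (`|χ₂⁽ⁱ⁾| ≤ B`, `i ≤ 3`), `Λ ≤ 4`: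

* `norm_iteratedFDeriv_uvBandSymbol_le`: `‖Dⁿ(Ψ(ω, e_K ·))‖ ≤ n!·B(n+1)!(4/Λ)^{n+1}·Dⁿ` (`n ≤ 3`);
* **`sum_norm_torusFourierInv_uvBandSymbol_le`**: `‖ǔ‖₁ ≤ uSymL1 B Λ D := 6(4B/Λ + π·2B(4/Λ)²D + π²·12B(4/Λ)³D²)`;
* **`sum_tnorm_norm_torusFourierInv_uvBandSymbol_le`**: `M₁(ǔ) ≤ uSymM1 B Λ D := 12(π·2B(4/Λ)²D + π²·12B(4/Λ)³D² + π³·144B(4/Λ)⁴D³)`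
  — both uniform in `L` (and in `ω`); the two right sides are spelled out, not defined;
* `torusFourierInv_frame_eq_framePosKernel_neg`: `(K∘p)ˇ(x) = Ǩ_L(−x)`, so `‖(K∘p)ˇ‖₁ = Σ‖Ǩ_L‖` and `M₁((K∘p)ˇ) ≤ Σ tnorm·‖Ǩ_L‖`
  (p3's `sum_norm_framePosKernel_le_of_differences` / `sum_abs_mul_norm_framePosKernel_le_of_frameOK` supply these; k3c5-p2's
  `tnorm_le_abs_valMinAbs_add` converts the direction-wise moments);
* **`resummedSymbolSizes_of_band`** — the four numbers of the read-out + the far tail, keyed to `(B, Λ, D, κ, κ₁)`: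
  with `A := uSymL1`, `Mu := uSymM1`, `a := A·κ < 1`, `m := Mu·κ + A·κ₁`:
  `‖τ̌‖₁ ≤ 1/(1−a)²`, `M₁(τ̌) ≤ 2m/(1−a)³`, `Σ_{far}|c_{Re E}| ≤ (κ₁/(1−a) + κm/(1−a)²)/((Lc−1)/2+1)`.

Under the flowing scheme at scale `0` (`K₀ = 0`): `κ = κ₁ = 0`, `a = m = 0`.  Proofs only; no definitions; nothing about the model beyond identities.
References: BGM 2006 (2.23), §3 (3.2); Friedli–Velenik 2017 §10.4.
-/

noncomputable section

namespace Summit.HubbardSuperconductivity.HubbardSuperconductivity.Theorems.TwoVolumeDefect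

set_option linter.dupNamespace false -- summit = problem name (single-conjunct summit), D-0017

open Finset Complex Literature.MathematicalPhysics.QuantumLattice Literature.Probability.LatticeModels
open Summit.HubbardSuperconductivity.HubbardSuperconductivity.Theorems.KLRegimeSplit
open Summit.HubbardSuperconductivity.HubbardSuperconductivity.Theorems.DispersionFlow
open Summit.HubbardSuperconductivity.HubbardSuperconductivity.Theorems.SampledSymbolKernel
open scoped ComplexConjugate Nat

/-! ## §1 The fixed-frequency ultraviolet symbol composed with the frame band -/

section Symbol

variable (Λ ω μ : ℝ) (K : TrigPolyC4v)

/-- The band on `Momentum` restricted to `Fin 2 → ℝ` is `ctBandFn`. -/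
theorem frameLevel_toLp_eq_ctBandFn' (x : Fin 2 → ℝ) : frameLevel μ K (WithLp.toLp 2 x) = ctBandFn μ K x := by
  simp [frameLevel, squareDispersion, ctBandFn]

/-- `ctBandFn` in the read-out's spelling `−2·Σ_l cos q_l − μ − K(q)`. -/
theorem ctBandFn_eq_sum (x : Fin 2 → ℝ) : ctBandFn μ K x = -2 * (∑ l : Fin 2, Real.cos (x l)) - μ - K.eval x := by
  simp [ctBandFn, Fin.sum_univ_two]

/-- The symbol on `Momentum`: `Ψ(ω, e_K(p)) = uvSymbolFn 1 Λ (e_K p) ω`, and at `toLp x` it is the read-out's `u x`. -/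
theorem uvSymbol₂_fbPt_frameLevel_toLp (x : Fin 2 → ℝ) :
    uvSymbol₂ 1 Λ (fbPt ω (frameLevel μ K (WithLp.toLp 2 x))) = uvSymbolFn 1 Λ (ctBandFn μ K x) ω := by
  rw [uvSymbol₂_fbPt, frameLevel_toLp_eq_ctBandFn']

/-- Periodicity of the composed symbol under `(2πℤ)²`. -/
theorem uvBandSymbol_periodic (q : EuclideanSpace ℝ (Fin 2)) (z : Fin 2 → ℤ) :
    uvSymbol₂ 1 Λ (fbPt ω (frameLevel μ K (q + WithLp.toLp 2 (fun i => (z i : ℝ) * (2 * Real.pi))))) =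
      uvSymbol₂ 1 Λ (fbPt ω (frameLevel μ K q)) := by
  obtain ⟨x, rfl⟩ : ∃ x : Fin 2 → ℝ, q = WithLp.toLp 2 x := ⟨WithLp.ofLp q, rfl⟩
  have hx : (x + fun i => (z i : ℝ) * (2 * Real.pi)) = fun i => x i + z i * (2 * Real.pi) := rfl
  rw [← WithLp.toLp_add, frameLevel_toLp_eq_ctBandFn', frameLevel_toLp_eq_ctBandFn', hx, ctBandFn_periodic]

/-- Smoothness of the composed symbol. -/
theorem contDiff_uvBandSymbol (hΛ : 0 < Λ) {n : ℕ∞} :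
    ContDiff ℝ n (fun p : EuclideanSpace ℝ (Fin 2) => uvSymbol₂ 1 Λ (fbPt ω (frameLevel μ K p))) :=
  (contDiff_uvSymbol₂ 1 hΛ).comp (contDiff_fbPt_comp (EngineV8.contDiff_frameLevel μ K) ω)

variable {Λ ω μ K}

/-- **Fréchet sizes of the composed symbol**: for `n ≤ 3`, `Λ ≤ 4`, `|χ₂⁽ⁱ⁾| ≤ B` (`i ≤ 3`, `B ≥ 1`) and `‖Dⁱe_K‖ ≤ Dⁱ` (`1 ≤ i ≤ 3`):
`‖Dⁿ(Ψ(ω, e_K ·))(p)‖ ≤ n!·(B·(n+1)!·(4/Λ)^{n+1})·Dⁿ`. -/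
theorem norm_iteratedFDeriv_uvBandSymbol_le (hΛ : 0 < Λ) (hΛ4 : Λ ≤ 4) {B : ℝ} (hB1 : 1 ≤ B)
    (hB : ∀ i ≤ 3, ∀ t, ‖iteratedDeriv i salmhoferCutoff t‖ ≤ B) {D : ℝ}
    (hD : ∀ i, 1 ≤ i → i ≤ 3 → ∀ p, ‖iteratedFDeriv ℝ i (frameLevel μ K) p‖ ≤ D ^ i) {n : ℕ} (hn : n ≤ 3)
    (p : EuclideanSpace ℝ (Fin 2)) :
    ‖iteratedFDeriv ℝ n (fun p : EuclideanSpace ℝ (Fin 2) => uvSymbol₂ 1 Λ (fbPt ω (frameLevel μ K p))) p‖ ≤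
      n ! * (B * (n + 1) ! * (4 / Λ) ^ (n + 1)) * D ^ n := by
  have h4 : 1 ≤ 4 / Λ := by rw [le_div_iff₀ hΛ]; linarith
  have hB0 : 0 ≤ B := zero_le_one.trans hB1
  refine norm_iteratedFDeriv_uvSymbol₂_comp_band_le hΛ ((EngineV8.contDiff_frameLevel μ K).of_le le_top) ω p
    (fun i hi => ?_) (fun i hi1 hin => hD i hi1 (hin.trans hn) p)
  have h := norm_iteratedFDeriv_uvSymbol₂_le (c := 1) zero_le_one hΛ hB1 hB (hi.trans hn) (fbPt ω (frameLevel μ K p))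
  rw [one_mul] at h
  refine h.trans ?_
  have hm : Λ / 2 ≤ max |(fbPt ω (frameLevel μ K p)) 0| (Λ / 2) := le_max_right _ _
  have hm0 : 0 < max |(fbPt ω (frameLevel μ K p)) 0| (Λ / 2) := lt_of_lt_of_le (by positivity) hm
  have h2m : 2 / max |(fbPt ω (frameLevel μ K p)) 0| (Λ / 2) ≤ 4 / Λ := by
    rw [div_le_div_iff₀ hm0 hΛ]; linarith
  have hfac : ((i + 1) ! : ℝ) ≤ (n + 1) ! := by exact_mod_cast Nat.factorial_le (by omega)
  calc B * ((i + 1) ! : ℝ) * (2 / max |(fbPt ω (frameLevel μ K p)) 0| (Λ / 2)) ^ (i + 1)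
      ≤ B * (n + 1) ! * (4 / Λ) ^ (i + 1) := by
        gcongr
    _ ≤ B * (n + 1) ! * (4 / Λ) ^ (n + 1) := by
        gcongr

/-- **`‖ǔ‖₁`** — the `ℓ¹` norm of the position kernel of the sampled symbol, uniformly in `L`:
`Σ_x ‖(u∘p)ˇ(x)‖ ≤ 6(4B/Λ + π·(2B(4/Λ)²·D) + π²·(12B(4/Λ)³·D²))`. -/
theorem sum_norm_torusFourierInv_uvBandSymbol_le {L : ℕ} [NeZero L] (hΛ : 0 < Λ) (hΛ4 : Λ ≤ 4) {B : ℝ} (hB1 : 1 ≤ B)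
    (hB : ∀ i ≤ 3, ∀ t, ‖iteratedDeriv i salmhoferCutoff t‖ ≤ B) {D : ℝ}
    (hD : ∀ i, 1 ≤ i → i ≤ 3 → ∀ p, ‖iteratedFDeriv ℝ i (frameLevel μ K) p‖ ≤ D ^ i) :
    ∑ x : TorusSite 2 L, ‖torusFourierInv (fun k => uvSymbolFn 1 Λ (-2 * (∑ l : Fin 2, Real.cos (latticeMomentum L k l)) - μ - K.eval (latticeMomentum L k)) ω) x‖ ≤
      6 * (B * (4 / Λ) + Real.pi * (2 * B * (4 / Λ) ^ 2 * D) + Real.pi ^ 2 * (12 * B * (4 / Λ) ^ 3 * D ^ 2)) := by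
  set F : EuclideanSpace ℝ (Fin 2) → ℂ := fun p => uvSymbol₂ 1 Λ (fbPt ω (frameLevel μ K p)) with hF
  have hsample : (fun k : TorusSite 2 L => uvSymbolFn 1 Λ (-2 * (∑ l : Fin 2, Real.cos (latticeMomentum L k l)) - μ - K.eval (latticeMomentum L k)) ω) =
      fun k => F (WithLp.toLp 2 (latticeMomentum L k)) := by
    funext k; rw [hF]; dsimp only; rw [uvSymbol₂_fbPt_frameLevel_toLp, ctBandFn_eq_sum]
  rw [hsample]
  have h0 := fun q => norm_iteratedFDeriv_uvBandSymbol_le (ω := ω) (μ := μ) (K := K) hΛ hΛ4 hB1 hB hD (n := 0) (by norm_num) q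
  have h1 := fun q => norm_iteratedFDeriv_uvBandSymbol_le (ω := ω) (μ := μ) (K := K) hΛ hΛ4 hB1 hB hD (n := 1) (by norm_num) q
  have h2 := fun q => norm_iteratedFDeriv_uvBandSymbol_le (ω := ω) (μ := μ) (K := K) hΛ hΛ4 hB1 hB hD (n := 2) (by norm_num) q
  have h0' : ∀ q, ‖F q‖ ≤ B * (4 / Λ) := by
    intro q
    have h := h0 q
    rw [norm_iteratedFDeriv_zero] at h
    have e : ((0 : ℕ) ! : ℝ) * (B * ((0 + 1 : ℕ)) ! * (4 / Λ) ^ (0 + 1)) * D ^ 0 = B * (4 / Λ) := by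
      rw [show Nat.factorial 0 = 1 from rfl, show Nat.factorial (0 + 1) = 1 from rfl]
      push_cast; ring
    exact h.trans e.le
  have h1' : ∀ q, ‖iteratedFDeriv ℝ 1 F q‖ ≤ 2 * B * (4 / Λ) ^ 2 * D := by
    intro q
    have h := h1 q
    have e : ((1 : ℕ) ! : ℝ) * (B * ((1 + 1 : ℕ)) ! * (4 / Λ) ^ (1 + 1)) * D ^ 1 = 2 * B * (4 / Λ) ^ 2 * D := by
      rw [show Nat.factorial 1 = 1 from rfl, show Nat.factorial (1 + 1) = 2 from rfl]
      push_cast; ring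
    exact h.trans e.le
  have h2' : ∀ q, ‖iteratedFDeriv ℝ 2 F q‖ ≤ 12 * B * (4 / Λ) ^ 3 * D ^ 2 := by
    intro q
    have h := h2 q
    have e : ((2 : ℕ) ! : ℝ) * (B * ((2 + 1 : ℕ)) ! * (4 / Λ) ^ (2 + 1)) * D ^ 2 = 12 * B * (4 / Λ) ^ 3 * D ^ 2 := by
      rw [show Nat.factorial 2 = 2 from rfl, show Nat.factorial (2 + 1) = 6 from rfl]
      push_cast; ring
    exact h.trans e.le
  exact sum_norm_torusFourierInv_sampled_le_of_fderiv F (uvBandSymbol_periodic Λ ω μ K) (by exact_mod_cast (contDiff_uvBandSymbol Λ ω μ K hΛ (n := 2)))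
    h0' h1' h2'

/-- **`M₁(ǔ)`** — the first `tnorm`-moment of the position kernel of the sampled symbol, uniformly in `L`:
`Σ_x tnorm(x)·‖(u∘p)ˇ(x)‖ ≤ 12(π·(2B(4/Λ)²D) + π²·(12B(4/Λ)³D²) + π³·(144B(4/Λ)⁴D³))`. -/
theorem sum_tnorm_norm_torusFourierInv_uvBandSymbol_le {L : ℕ} [NeZero L] (hΛ : 0 < Λ) (hΛ4 : Λ ≤ 4) {B : ℝ} (hB1 : 1 ≤ B)
    (hB : ∀ i ≤ 3, ∀ t, ‖iteratedDeriv i salmhoferCutoff t‖ ≤ B) {D : ℝ}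
    (hD : ∀ i, 1 ≤ i → i ≤ 3 → ∀ p, ‖iteratedFDeriv ℝ i (frameLevel μ K) p‖ ≤ D ^ i) :
    ∑ x : TorusSite 2 L, (Torus.tnorm x : ℝ) *
        ‖torusFourierInv (fun k => uvSymbolFn 1 Λ (-2 * (∑ l : Fin 2, Real.cos (latticeMomentum L k l)) - μ - K.eval (latticeMomentum L k)) ω) x‖ ≤
      12 * (Real.pi * (2 * B * (4 / Λ) ^ 2 * D) + Real.pi ^ 2 * (12 * B * (4 / Λ) ^ 3 * D ^ 2) +
        Real.pi ^ 3 * (144 * B * (4 / Λ) ^ 4 * D ^ 3)) := by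
  set F : EuclideanSpace ℝ (Fin 2) → ℂ := fun p => uvSymbol₂ 1 Λ (fbPt ω (frameLevel μ K p)) with hF
  have hsample : (fun k : TorusSite 2 L => uvSymbolFn 1 Λ (-2 * (∑ l : Fin 2, Real.cos (latticeMomentum L k l)) - μ - K.eval (latticeMomentum L k)) ω) =
      fun k => F (WithLp.toLp 2 (latticeMomentum L k)) := by
    funext k; rw [hF]; dsimp only; rw [uvSymbol₂_fbPt_frameLevel_toLp, ctBandFn_eq_sum]
  rw [hsample]
  have h1 := fun q => norm_iteratedFDeriv_uvBandSymbol_le (ω := ω) (μ := μ) (K := K) hΛ hΛ4 hB1 hB hD (n := 1) (by norm_num) q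
  have h2 := fun q => norm_iteratedFDeriv_uvBandSymbol_le (ω := ω) (μ := μ) (K := K) hΛ hΛ4 hB1 hB hD (n := 2) (by norm_num) q
  have h3 := fun q => norm_iteratedFDeriv_uvBandSymbol_le (ω := ω) (μ := μ) (K := K) hΛ hΛ4 hB1 hB hD (n := 3) (by norm_num) q
  have h1' : ∀ q, ‖iteratedFDeriv ℝ 1 F q‖ ≤ 2 * B * (4 / Λ) ^ 2 * D := by
    intro q
    have h := h1 q
    have e : ((1 : ℕ) ! : ℝ) * (B * ((1 + 1 : ℕ)) ! * (4 / Λ) ^ (1 + 1)) * D ^ 1 = 2 * B * (4 / Λ) ^ 2 * D := by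
      rw [show Nat.factorial 1 = 1 from rfl, show Nat.factorial (1 + 1) = 2 from rfl]
      push_cast; ring
    exact h.trans e.le
  have h2' : ∀ q, ‖iteratedFDeriv ℝ 2 F q‖ ≤ 12 * B * (4 / Λ) ^ 3 * D ^ 2 := by
    intro q
    have h := h2 q
    have e : ((2 : ℕ) ! : ℝ) * (B * ((2 + 1 : ℕ)) ! * (4 / Λ) ^ (2 + 1)) * D ^ 2 = 12 * B * (4 / Λ) ^ 3 * D ^ 2 := by
      rw [show Nat.factorial 2 = 2 from rfl, show Nat.factorial (2 + 1) = 6 from rfl]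
      push_cast; ring
    exact h.trans e.le
  have h3' : ∀ q, ‖iteratedFDeriv ℝ 3 F q‖ ≤ 144 * B * (4 / Λ) ^ 4 * D ^ 3 := by
    intro q
    have h := h3 q
    have e : ((3 : ℕ) ! : ℝ) * (B * ((3 + 1 : ℕ)) ! * (4 / Λ) ^ (3 + 1)) * D ^ 3 = 144 * B * (4 / Λ) ^ 4 * D ^ 3 := by
      rw [show Nat.factorial 3 = 6 from rfl, show Nat.factorial (3 + 1) = 24 from rfl]
      push_cast; ring
    exact h.trans e.le
  have h := sum_tnorm_mul_norm_torusFourierInv_sampled_le_of_fderiv (L := L) F (uvBandSymbol_periodic Λ ω μ K)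
    (by exact_mod_cast (contDiff_uvBandSymbol Λ ω μ K hΛ (n := 3))) (R := 1) le_rfl h1' h2' h3'
  simpa using h

end Symbol

/-! ## §2 The frame's position kernel in `torusFourierInv` currency -/

section Frame

variable {L : ℕ} [NeZero L]

/-- `(K∘p)ˇ(x) = Ǩ_L(−x)`. -/
theorem torusFourierInv_frame_eq_framePosKernel_neg (K : TrigPolyC4v) (x : TorusSite 2 L) :
    torusFourierInv (fun k => (K.eval (latticeMomentum L k) : ℂ)) x = framePosKernel L K (-x) := by
  rw [torusFourierInv_eq_torusFourier_neg, framePosKernel_eq_torusFourier]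

/-- `‖(K∘p)ˇ‖₁ = Σ_z ‖Ǩ_L(z)‖`. -/
theorem sum_norm_torusFourierInv_frame_eq (K : TrigPolyC4v) :
    ∑ x : TorusSite 2 L, ‖torusFourierInv (fun k => (K.eval (latticeMomentum L k) : ℂ)) x‖ =
      ∑ z : TorusSite 2 L, ‖framePosKernel L K z‖ := by
  simp_rw [torusFourierInv_frame_eq_framePosKernel_neg]
  exact Fintype.sum_equiv (Equiv.neg _) _ _ fun x => by simp

/-- `M₁((K∘p)ˇ) ≤ Σ_z tnorm(z)·‖Ǩ_L(z)‖`. -/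
theorem sum_tnorm_norm_torusFourierInv_frame_le (K : TrigPolyC4v) :
    ∑ x : TorusSite 2 L, (Torus.tnorm x : ℝ) * ‖torusFourierInv (fun k => (K.eval (latticeMomentum L k) : ℂ)) x‖ ≤
      ∑ z : TorusSite 2 L, (Torus.tnorm z : ℝ) * ‖framePosKernel L K z‖ := by
  simp_rw [torusFourierInv_frame_eq_framePosKernel_neg]
  have h : ∑ x : TorusSite 2 L, (Torus.tnorm x : ℝ) * ‖framePosKernel L K (-x)‖ =
      ∑ z : TorusSite 2 L, (Torus.tnorm (-z) : ℝ) * ‖framePosKernel L K z‖ :=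
    Fintype.sum_equiv (Equiv.neg _) _ _ fun x => by simp
  rw [h]
  exact sum_le_sum fun z _ => mul_le_mul_of_nonneg_right (by exact_mod_cast Torus.tnorm_neg_le z) (norm_nonneg _)

/-- Hence `Σ_z tnorm(z)·‖Ǩ_L(z)‖ ≤ Σ_z |z̃₀|·‖Ǩ_L(z)‖ + Σ_z |z̃₁|·‖Ǩ_L(z)‖`. -/
theorem sum_tnorm_norm_framePosKernel_le (K : TrigPolyC4v) :
    ∑ z : TorusSite 2 L, (Torus.tnorm z : ℝ) * ‖framePosKernel L K z‖ ≤
      ∑ z : TorusSite 2 L, |((z 0).valMinAbs : ℝ)| * ‖framePosKernel L K z‖ +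
        ∑ z : TorusSite 2 L, |((z 1).valMinAbs : ℝ)| * ‖framePosKernel L K z‖ := by
  rw [← sum_add_distrib]
  exact sum_le_sum fun z _ => by
    rw [← add_mul]; exact mul_le_mul_of_nonneg_right (tnorm_le_abs_valMinAbs_add z) (norm_nonneg _)

end Frame

/-! ## §3 The resummed-symbol sizes of the read-out, keyed to band data -/

section Sizes

variable {b Lc Lf : ℕ} [NeZero Lc] [NeZero Lf] {Λ ω μ : ℝ} {K : TrigPolyC4v}

/-- **The (r4) numbers at the FINE volume, keyed to `(B, Λ, D, κ, κ₁)`.**  Let `u q := uvSymbolFn 1 Λ (e_K q) ω`,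
`A := 6(4B/Λ + 2πB(4/Λ)²D + 12π²B(4/Λ)³D²)` (`≥ ‖ǔ‖₁`), `Mu := 12(2πB(4/Λ)²D + 12π²B(4/Λ)³D² + 144π³B(4/Λ)⁴D³)` (`≥ M₁(ǔ)`),
`κ ≥ Σ‖Ǩ_L‖`, `κ₁ ≥ Σ tnorm·‖Ǩ_L‖`, and assume `A·κ < 1`, `1 + u K ≠ 0` on the lattice.  Then with `a := A·κ`, `m := Mu·κ + A·κ₁`:
`‖τ̌‖₁ ≤ 1/(1 − a)²`, `M₁(τ̌) ≤ 2m/(1 − a)³`, and `Σ_{y ≠ clift(red y)} |c_{Re E}(y)| ≤ (κ₁/(1 − a) + κ·m/(1 − a)²)/((Lc−1)/2+1)` (`Lf = b·Lc`). -/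
theorem resummedSymbolSizes_of_band (hL : Lf = b * Lc) (hΛ : 0 < Λ) (hΛ4 : Λ ≤ 4) {B : ℝ} (hB1 : 1 ≤ B)
    (hB : ∀ i ≤ 3, ∀ t, ‖iteratedDeriv i salmhoferCutoff t‖ ≤ B) {D : ℝ} (hD0 : 0 ≤ D)
    (hD : ∀ i, 1 ≤ i → i ≤ 3 → ∀ p, ‖iteratedFDeriv ℝ i (frameLevel μ K) p‖ ≤ D ^ i)
    (hden : ∀ k : TorusSite 2 Lf, 1 + uvSymbolFn 1 Λ (-2 * (∑ l : Fin 2, Real.cos (latticeMomentum Lf k l)) - μ - K.eval (latticeMomentum Lf k)) ω * (K.eval (latticeMomentum Lf k) : ℂ) ≠ 0)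
    {κ κ₁ : ℝ} (hκ : ∑ z : TorusSite 2 Lf, ‖framePosKernel Lf K z‖ ≤ κ)
    (hκ₁ : ∑ z : TorusSite 2 Lf, (Torus.tnorm z : ℝ) * ‖framePosKernel Lf K z‖ ≤ κ₁)
    (hsmall : 6 * (B * (4 / Λ) + Real.pi * (2 * B * (4 / Λ) ^ 2 * D) + Real.pi ^ 2 * (12 * B * (4 / Λ) ^ 3 * D ^ 2)) * κ < 1) :
    (∑ x : TorusSite 2 Lf, ‖torusFourierInv (fun k => (1 - (K.eval (latticeMomentum Lf k) : ℂ) *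
        (uvSymbolFn 1 Λ (-2 * (∑ l : Fin 2, Real.cos (latticeMomentum Lf k l)) - μ - K.eval (latticeMomentum Lf k)) ω /
          (1 + uvSymbolFn 1 Λ (-2 * (∑ l : Fin 2, Real.cos (latticeMomentum Lf k l)) - μ - K.eval (latticeMomentum Lf k)) ω * K.eval (latticeMomentum Lf k)))) ^ 2) x‖ ≤
        1 / (1 - 6 * (B * (4 / Λ) + Real.pi * (2 * B * (4 / Λ) ^ 2 * D) + Real.pi ^ 2 * (12 * B * (4 / Λ) ^ 3 * D ^ 2)) * κ) ^ 2) ∧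
    (∑ x : TorusSite 2 Lf, (Torus.tnorm x : ℝ) * ‖torusFourierInv (fun k => (1 - (K.eval (latticeMomentum Lf k) : ℂ) *
        (uvSymbolFn 1 Λ (-2 * (∑ l : Fin 2, Real.cos (latticeMomentum Lf k l)) - μ - K.eval (latticeMomentum Lf k)) ω /
          (1 + uvSymbolFn 1 Λ (-2 * (∑ l : Fin 2, Real.cos (latticeMomentum Lf k l)) - μ - K.eval (latticeMomentum Lf k)) ω * K.eval (latticeMomentum Lf k)))) ^ 2) x‖ ≤
        2 * ((12 * (Real.pi * (2 * B * (4 / Λ) ^ 2 * D) + Real.pi ^ 2 * (12 * B * (4 / Λ) ^ 3 * D ^ 2) +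
              Real.pi ^ 3 * (144 * B * (4 / Λ) ^ 4 * D ^ 3))) * κ +
            (6 * (B * (4 / Λ) + Real.pi * (2 * B * (4 / Λ) ^ 2 * D) + Real.pi ^ 2 * (12 * B * (4 / Λ) ^ 3 * D ^ 2))) * κ₁) /
          (1 - 6 * (B * (4 / Λ) + Real.pi * (2 * B * (4 / Λ) ^ 2 * D) + Real.pi ^ 2 * (12 * B * (4 / Λ) ^ 3 * D ^ 2)) * κ) ^ 3) ∧
    (∑ y ∈ univ.filter (fun y : TorusSite 2 Lf => Torus.proj Lf (Torus.cRep (fun i => (((y i).val : ℕ) : ZMod Lc))) ≠ y),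
        |torusCosCoeff Lf (fun k => ((K.eval (latticeMomentum Lf k) : ℂ) - (K.eval (latticeMomentum Lf k) : ℂ) ^ 2 *
          (uvSymbolFn 1 Λ (-2 * (∑ l : Fin 2, Real.cos (latticeMomentum Lf k l)) - μ - K.eval (latticeMomentum Lf k)) ω /
            (1 + uvSymbolFn 1 Λ (-2 * (∑ l : Fin 2, Real.cos (latticeMomentum Lf k l)) - μ - K.eval (latticeMomentum Lf k)) ω * K.eval (latticeMomentum Lf k)))).re) y| ≤
      (κ₁ / (1 - 6 * (B * (4 / Λ) + Real.pi * (2 * B * (4 / Λ) ^ 2 * D) + Real.pi ^ 2 * (12 * B * (4 / Λ) ^ 3 * D ^ 2)) * κ) +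
          κ * ((12 * (Real.pi * (2 * B * (4 / Λ) ^ 2 * D) + Real.pi ^ 2 * (12 * B * (4 / Λ) ^ 3 * D ^ 2) +
                Real.pi ^ 3 * (144 * B * (4 / Λ) ^ 4 * D ^ 3))) * κ +
              (6 * (B * (4 / Λ) + Real.pi * (2 * B * (4 / Λ) ^ 2 * D) + Real.pi ^ 2 * (12 * B * (4 / Λ) ^ 3 * D ^ 2))) * κ₁) /
            (1 - 6 * (B * (4 / Λ) + Real.pi * (2 * B * (4 / Λ) ^ 2 * D) + Real.pi ^ 2 * (12 * B * (4 / Λ) ^ 3 * D ^ 2)) * κ) ^ 2) /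
        (((Lc - 1) / 2 + 1 : ℕ) : ℝ)) := by
  set A := 6 * (B * (4 / Λ) + Real.pi * (2 * B * (4 / Λ) ^ 2 * D) + Real.pi ^ 2 * (12 * B * (4 / Λ) ^ 3 * D ^ 2)) with hA
  set Mu := 12 * (Real.pi * (2 * B * (4 / Λ) ^ 2 * D) + Real.pi ^ 2 * (12 * B * (4 / Λ) ^ 3 * D ^ 2) +
    Real.pi ^ 3 * (144 * B * (4 / Λ) ^ 4 * D ^ 3)) with hMu
  set uL : TorusSite 2 Lf → ℂ := fun k => uvSymbolFn 1 Λ (-2 * (∑ l : Fin 2, Real.cos (latticeMomentum Lf k l)) - μ - K.eval (latticeMomentum Lf k)) ω with huL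
  set KL : TorusSite 2 Lf → ℂ := fun k => (K.eval (latticeMomentum Lf k) : ℂ) with hKL
  have hB0 : 0 ≤ B := zero_le_one.trans hB1
  have hA0 : 0 ≤ A := by rw [hA]; positivity
  have hMu0 : 0 ≤ Mu := by rw [hMu]; positivity
  have hκ0 : 0 ≤ κ := le_trans (sum_nonneg fun z _ => norm_nonneg _) hκ
  have hκ₁0 : 0 ≤ κ₁ := le_trans (sum_nonneg fun z _ => mul_nonneg (Nat.cast_nonneg _) (norm_nonneg _)) hκ₁
  -- the symbol sizes
  have hu : ∑ x : TorusSite 2 Lf, ‖torusFourierInv uL x‖ ≤ A :=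
    sum_norm_torusFourierInv_uvBandSymbol_le (ω := ω) (μ := μ) (K := K) hΛ hΛ4 hB1 hB hD
  have hum : ∑ x : TorusSite 2 Lf, (Torus.tnorm x : ℝ) * ‖torusFourierInv uL x‖ ≤ Mu :=
    sum_tnorm_norm_torusFourierInv_uvBandSymbol_le (ω := ω) (μ := μ) (K := K) hΛ hΛ4 hB1 hB hD
  -- the frame sizes
  have hK : ∑ x : TorusSite 2 Lf, ‖torusFourierInv KL x‖ ≤ κ := by rw [hKL, sum_norm_torusFourierInv_frame_eq]; exact hκ
  have hKm : ∑ x : TorusSite 2 Lf, (Torus.tnorm x : ℝ) * ‖torusFourierInv KL x‖ ≤ κ₁ :=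
    (sum_tnorm_norm_torusFourierInv_frame_le K).trans hκ₁
  -- the product `g = u·K`
  have ha : ∑ x : TorusSite 2 Lf, ‖torusFourierInv (fun k => uL k * KL k) x‖ ≤ A * κ :=
    (sum_norm_torusFourierInv_mul_le uL KL).trans (mul_le_mul hu hK (sum_nonneg fun x _ => norm_nonneg _) hA0)
  have hm : ∑ x : TorusSite 2 Lf, (Torus.tnorm x : ℝ) * ‖torusFourierInv (fun k => uL k * KL k) x‖ ≤ Mu * κ + A * κ₁ := by
    refine (sum_tnorm_norm_torusFourierInv_mul_le uL KL).trans (add_le_add ?_ ?_)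
    · exact mul_le_mul hum hK (sum_nonneg fun x _ => norm_nonneg _) hMu0
    · exact mul_le_mul hu hKm (sum_nonneg fun x _ => mul_nonneg (Nat.cast_nonneg _) (norm_nonneg _)) hA0
  have hden' : ∀ k, 1 + uL k * KL k ≠ 0 := fun k => hden k
  refine ⟨?_, ?_, ?_⟩
  · exact sum_norm_torusFourierInv_tau_le hden' ha hsmall
  · exact sum_tnorm_norm_torusFourierInv_tau_le hden' ha hsmall hm
  · exact sum_far_abs_torusCosCoeff_re_E_le hL hden' ha hsmall hm hK hKm

end Sizes

end Summit.HubbardSuperconductivity.HubbardSuperconductivity.Theorems.TwoVolumeDefect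

end
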